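import Literature.NumberTheory.Automorphic.ArchLocalRelabelTransport       -- ★ p840351: `e_σ`, `relabel_circleDiagonal`
import Literature.NumberTheory.Automorphic.ArchTorusOrbitalFunction          -- ★ (V2′): brings `quotientMeasure`, `descConj` on `archLocal`
import Literature.MeasureTheory.Group.InvariantQuotientTransport             -- ★ `map_cosetCongr_quotientMeasure`, `cosetCongr`, `subgroupCongrHomeomorph`
import Literature.MeasureTheory.Group.InvariantQuotientCompactSubgroup       -- ★ `measure_univ_smul_quotientMeasure_eq_map_mk`
import Literature.MeasureTheory.Group.InvariantQuotientOrbitalTransport      -- ★ `forall_apply_mem_centralizer_singleton_iff_of_eq`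
import Literature.NumberTheory.Automorphic.LocalOrbitalMeasure               -- ★ `isClosed_coe_centralizer_singleton`
import HarnessLib

/-!
# Wall orbit measures: transport of the singular quotient orbit measure along a group isomorphism, and the compact-wall reading ((R1-h-a), (R1-h-b))
(Deitmar–Echterhoff (2014) Thm. 1.5.3; Folland (1995) §2.6 (2.52); Rogawski (1990) §8.2 pp. 122–124)

Topic `NumberTheory/Rogawski1990` (§2) over a generic §1 in namespace `Literature.MeasureTheory.Group`.  THEOREMS ONLY (no definition, no instance, no notation, no named fact,
no `sorry`).  Cell `hodgecm-mathlib`, crux H413 (`stmt-HodgeConjecture-24833`); LEAD F0P3a-plan (g9) WORD T8-104 (2) ((R1-h) «END-STATE SIGNED REGROUPING», sub-bricks (R1-h-a),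
(R1-h-b) of F0P3a-p07 (g7)'s HANDOFF :31–:32); F0P3-p03 (g9).  Count-neutral floor-1 plumbing under books rows #88 (ST-∞) ∕ #111 (S-d); HC_CM is proved only modulo the printed
citations until rung 0 closes.

THE TWO READINGS OF A WALL MEASURE (the `Wm_v(ρ)` of ★ p841698 `exists_wallCoef_hstep`):
* (R1-h-a) SINGULAR WALL — TRANSPORT: the singular wall measure is the image of the invariant quotient measure `dν ∕ dν_H` under the orbit map `ȳ ↦ y γ y⁻¹` (`descConj γ H _ id`);
  along an isomorphism of topological groups `e : G ≃* G′` with `e(H) = H′`, `ρ′ = (e|_H)_* ρ`, `ν′ = e_* ν`: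
  `e_* ((dν∕dρ).map (ȳ ↦ y γ y⁻¹)) = (dν′∕dρ′).map (ȳ′ ↦ y′ e(γ) y′⁻¹)` (★ `map_cosetCongr_quotientMeasure` + `e ∘ descConj γ = descConj (e γ) ∘ cosetCongr e`);
  §2 instantiates it at ★ p840351's relabelling iso `e_σ : G_w(α∘σ) ≃ₜ* G_w(α)` with `e_σ (diag z) = diag (z∘σ⁻¹)` — p07's (R1-h-a) formula, `σ := ρ⁻¹`.
* (R1-h-b) COMPACT WALL: `ν.map (y ↦ y d y⁻¹) = ρ(H) • (dν∕dρ).map (ȳ ↦ y d y⁻¹)` for ANY closed `H` centralising `d` (★ `measure_univ_smul_quotientMeasure_eq_map_mk` + `descConj_mk`);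
  meaningful when `H` is compact (`ρ(H) < ∞`), e.g. the centraliser of a compact-wall torus point.

## References
* [DeitmarEchterhoff2014] A. Deitmar, S. Echterhoff, *Principles of Harmonic Analysis*, 2nd ed. (2014), Thm. 1.5.3 (the invariant quotient measure; naturality).
* [Folland1995] G. B. Folland, *A Course in Abstract Harmonic Analysis* (1995), §2.6 (2.52) (Weil's formula).
* [Rogawski1990] J. D. Rogawski, *Automorphic Representations of Unitary Groups in Three Variables*, Ann. of Math. Stud. 123 (1990), §8.2 pp. 122–124 (the wall terms of the
  stable orbital integral near a singular torus point; the relabelled classes).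
-/

set_option autoImplicit false

noncomputable section

open MeasureTheory Measure Filter Topology

/-! ## §1 Generic: orbit maps of quotient measures under group isomorphisms; the compact-subgroup reading -/

namespace Literature.MeasureTheory.Group

section Transport

variable {G G' : Type*} [Group G] [Group G'] [TopologicalSpace G] [TopologicalSpace G']
  [IsTopologicalGroup G] [IsTopologicalGroup G'] [LocallyCompactSpace G] [LocallyCompactSpace G']
  [SecondCountableTopology G] [SecondCountableTopology G'] [T2Space G] [T2Space G']
  [MeasurableSpace G] [BorelSpace G] [MeasurableSpace G'] [BorelSpace G']
  (e : G ≃* G') (he : Continuous e) (hes : Continuous e.symm)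
  (H : Subgroup G) [hH : IsClosed (H : Set G)] (H' : Subgroup G') [hH' : IsClosed (H' : Set G')]
  (hHH' : ∀ g, e g ∈ H' ↔ g ∈ H)
  [MeasurableSpace (G ⧸ H)] [BorelSpace (G ⧸ H)] [MeasurableSpace (G' ⧸ H')] [BorelSpace (G' ⧸ H')]
  (ρ : Measure H) [ρ.IsMulLeftInvariant] [IsFiniteMeasureOnCompacts ρ] [ρ.IsOpenPosMeasure]
  [ρ.IsInvInvariant] [SFinite ρ]
  (ρ' : Measure H') [ρ'.IsMulLeftInvariant] [IsFiniteMeasureOnCompacts ρ'] [ρ'.IsOpenPosMeasure]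
  [ρ'.IsInvInvariant] [SFinite ρ']
  (ν : Measure G) [IsHaarMeasure ν] [ν.IsMulRightInvariant]
  (ν' : Measure G') [IsHaarMeasure ν'] [ν'.IsMulRightInvariant]

omit [TopologicalSpace G] [TopologicalSpace G'] [IsTopologicalGroup G] [IsTopologicalGroup G'] [LocallyCompactSpace G] [LocallyCompactSpace G']
  [SecondCountableTopology G] [SecondCountableTopology G'] [T2Space G] [T2Space G'] [MeasurableSpace G] [BorelSpace G] [MeasurableSpace G'] [BorelSpace G']
  hH hH' [MeasurableSpace (G ⧸ H)] [BorelSpace (G ⧸ H)] [MeasurableSpace (G' ⧸ H')] [BorelSpace (G' ⧸ H')] in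
/-- **The orbit map intertwines**: `e ∘ (ȳ ↦ y γ y⁻¹) = (ȳ′ ↦ y′ e(γ) y′⁻¹) ∘ cosetCongr e`. [cite: DeitmarEchterhoff2014, Thm. 1.5.3] -/
theorem comp_descConj_id_eq_descConj_id_comp_cosetCongr {γ : G} {γ' : G'} (hγ : e γ = γ')
    (hHγ : ∀ g ∈ H, g * γ = γ * g) (hH'γ : ∀ g ∈ H', g * γ' = γ' * g) :
    (e : G → G') ∘ descConj γ H hHγ id = descConj γ' H' hH'γ id ∘ cosetCongr e H H' hHH' := by
  funext x
  induction x using QuotientGroup.induction_on with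
  | H g => simp only [Function.comp_apply, descConj_mk, id, cosetCongr_mk, map_mul, map_inv, hγ]

/-- **(R1-h-a) TRANSPORT OF THE SINGULAR WALL MEASURE ALONG A GROUP ISOMORPHISM.**  For `e : G ≃* G′` an isomorphism of topological groups, a closed `H ≤ G` centralising `γ` with
`e(H) = H′` (so `H′` centralises `e γ`), `ρ′ = (e|_H)_* ρ` and `ν′ = e_* ν`:
`e_* ((quotientMeasure H ρ ν).map (ȳ ↦ y γ y⁻¹)) = (quotientMeasure H′ ρ′ ν′).map (ȳ′ ↦ y′ (e γ) y′⁻¹)` — the image of the invariant quotient measure under the orbit map is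
NATURAL (★ `map_cosetCongr_quotientMeasure`). [cite: DeitmarEchterhoff2014, Thm. 1.5.3] [cite: Rogawski1990, §8.2 p. 123] -/
theorem map_map_descConj_id_quotientMeasure_eq_of_mulEquiv
    (hρ' : ρ' = Measure.map (subgroupCongrHomeomorph e H H' hHH' he hes) ρ) (hν' : ν' = Measure.map e ν)
    {γ : G} {γ' : G'} (hγ : e γ = γ') (hHγ : ∀ g ∈ H, g * γ = γ * g) (hH'γ : ∀ g ∈ H', g * γ' = γ' * g) :
    ((quotientMeasure H ρ hH ν).map (descConj γ H hHγ id)).map e =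
      (quotientMeasure H' ρ' hH' ν').map (descConj γ' H' hH'γ id) := by
  have hd : Measurable (descConj γ H hHγ (id : G → G)) := (continuous_descConj γ H hHγ continuous_id).measurable
  have hd' : Measurable (descConj γ' H' hH'γ (id : G' → G')) := (continuous_descConj γ' H' hH'γ continuous_id).measurable
  have hc : Measurable (cosetCongr e H H' hHH') := (continuous_cosetCongr e H H' hHH' he).measurable
  rw [Measure.map_map he.measurable hd, comp_descConj_id_eq_descConj_id_comp_cosetCongr e H H' hHH' hγ hHγ hH'γ, ← Measure.map_map hd' hc,
    map_cosetCongr_quotientMeasure e he hes H H' hHH' ρ ρ' ν ν' hρ' hν']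

end Transport

section Compact

variable {G : Type*} [Group G] [TopologicalSpace G] [IsTopologicalGroup G] [LocallyCompactSpace G]
  [SecondCountableTopology G] [T2Space G] [MeasurableSpace G] [BorelSpace G]
  (H : Subgroup G) [hH : IsClosed (H : Set G)]
  (ρ : Measure H) [ρ.IsMulLeftInvariant] [IsFiniteMeasureOnCompacts ρ] [ρ.IsOpenPosMeasure] [SFinite ρ] [ρ.IsInvInvariant]
  (ν : Measure G) [IsHaarMeasure ν] [ν.IsMulRightInvariant]
  [MeasurableSpace (G ⧸ H)] [BorelSpace (G ⧸ H)]

/-- **(R1-h-b) THE COMPACT-WALL READING.**  For a closed `H ≤ G` centralising `d`: the orbit measure of `ν` at `d` is `ρ(H)` times the image of the invariant quotient measure under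
the orbit map, `ν.map (y ↦ y d y⁻¹) = ρ(H) • (quotientMeasure H ρ ν).map (ȳ ↦ y d y⁻¹)` (Weil's formula `ρ(H) • μ_{G∕H} = π_* ν`, ★ `measure_univ_smul_quotientMeasure_eq_map_mk`,
composed with the orbit map).  Used with `H` compact (a compact-wall centraliser), where `ρ(H) < ∞`. [cite: Folland1995, §2.6 (2.52)] [cite: Rogawski1990, §8.2 p. 123] -/
theorem map_conj_eq_measure_univ_smul_map_descConj_id_quotientMeasure {d : G} (hHd : ∀ g ∈ H, g * d = d * g) :
    ν.map (fun y : G => y * d * y⁻¹) = ρ Set.univ • (quotientMeasure H ρ hH ν).map (descConj d H hHd id) := by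
  have hd : Measurable (descConj d H hHd (id : G → G)) := (continuous_descConj d H hHd continuous_id).measurable
  have hcomp : (fun y : G => y * d * y⁻¹) = descConj d H hHd id ∘ (QuotientGroup.mk : G → G ⧸ H) := by
    funext y
    simp only [Function.comp_apply, descConj_mk, id]
  rw [hcomp, ← Measure.map_map hd QuotientGroup.continuous_mk.measurable, ← measure_univ_smul_quotientMeasure_eq_map_mk H ρ ν, Measure.map_smul]

end Compact

end Literature.MeasureTheory.Group

/-! ## §2 The archimedean instance: the relabelling iso `e_σ : G_w(α∘σ) ≃ₜ* G_w(α)` -/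

namespace Literature.NumberTheory.Rogawski1990

open NumberField NumberField.InfinitePlace Matrix Equiv
open Literature.MeasureTheory.Group Literature.NumberTheory.Automorphic Literature.NumberTheory.Automorphic.UnitaryGroup
open Literature.LinearAlgebra.Matrix
open scoped Matrix MatrixGroups

variable (L : Type) [Field L] (N : ℕ) (α : Fin N → L) (w : {w : InfinitePlace L // IsComplex w}) (σ : Perm (Fin N))

/-- **(R1-h-a) FOR THE RELABELLING**: along ★ p840351's `e_σ : G_w(α∘σ) ≃ₜ* G_w(α)` (`e_σ (diag z) = diag (z∘σ⁻¹)`, ★ `relabel_circleDiagonal`), with the torus reference point `diag z₁`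
(source) ∕ `diag (z₁∘σ⁻¹)` (target) naming the centralisers, the singular wall measure at `diag z₀` on `G_w(α∘σ)` for `(ν₁, ν_{H,1})` is carried to the singular wall measure at
`diag (z₀∘σ⁻¹)` on `G_w(α)` for the transported `(ν = e_σ_* ν₁, ν_H = (e_σ|_Z)_* ν_{H,1})`.  (p07 (g7)'s (R1-h-a) with `σ := ρ⁻¹`, `(ρ⁻¹).symm = ρ`.)
[cite: Rogawski1990, §8.2 pp. 122–124] [cite: DeitmarEchterhoff2014, Thm. 1.5.3] -/
theorem map_relabel_map_descConj_id_quotientMeasure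
    [LocallyCompactSpace (archLocal L N (Matrix.diagonal (α ∘ σ)) w)] [SecondCountableTopology (archLocal L N (Matrix.diagonal (α ∘ σ)) w)] [MeasurableSpace (archLocal L N (Matrix.diagonal (α ∘ σ)) w)] [BorelSpace (archLocal L N (Matrix.diagonal (α ∘ σ)) w)]
    [LocallyCompactSpace (archLocal L N (Matrix.diagonal α) w)] [SecondCountableTopology (archLocal L N (Matrix.diagonal α) w)] [MeasurableSpace (archLocal L N (Matrix.diagonal α) w)] [BorelSpace (archLocal L N (Matrix.diagonal α) w)]
    (ν₁ : Measure (archLocal L N (Matrix.diagonal (α ∘ σ)) w)) [ν₁.IsHaarMeasure] [ν₁.IsMulRightInvariant]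
    (ν : Measure (archLocal L N (Matrix.diagonal α) w)) [ν.IsHaarMeasure] [ν.IsMulRightInvariant]
    (hν : ν = ν₁.map (ContinuousMulEquiv.restrictSubgroup (GLn.conjEquiv (Matrix.GeneralLinearGroup.mkOfDetNeZero _ (det_monomial_one_ne_zero N σ)))
        (archLocal L N (Matrix.diagonal (α ∘ σ)) w) (archLocal L N (Matrix.diagonal α) w) (mem_archLocal_comp_perm_iff_conj_mem L N α w σ)))
    (z₁ z₀ : Fin N → Circle)
    (h₁ : ∀ m ∈ Subgroup.centralizer ({(⟨circleDiagonal N z₁, circleDiagonal_mem_archLocal_diagonal L N (α ∘ σ) w _⟩ : archLocal L N (Matrix.diagonal (α ∘ σ)) w)} : Set (archLocal L N (Matrix.diagonal (α ∘ σ)) w)), m * (⟨circleDiagonal N z₀, circleDiagonal_mem_archLocal_diagonal L N (α ∘ σ) w _⟩ : archLocal L N (Matrix.diagonal (α ∘ σ)) w) = (⟨circleDiagonal N z₀, circleDiagonal_mem_archLocal_diagonal L N (α ∘ σ) w _⟩ : archLocal L N (Matrix.diagonal (α ∘ σ)) w) * m)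
    (h : ∀ m ∈ Subgroup.centralizer ({(⟨circleDiagonal N (fun i => z₁ (σ.symm i)), circleDiagonal_mem_archLocal_diagonal L N α w _⟩ : archLocal L N (Matrix.diagonal α) w)} : Set (archLocal L N (Matrix.diagonal α) w)), m * (⟨circleDiagonal N (fun i => z₀ (σ.symm i)), circleDiagonal_mem_archLocal_diagonal L N α w _⟩ : archLocal L N (Matrix.diagonal α) w) = (⟨circleDiagonal N (fun i => z₀ (σ.symm i)), circleDiagonal_mem_archLocal_diagonal L N α w _⟩ : archLocal L N (Matrix.diagonal α) w) * m)
    (νH₁ : Measure (Subgroup.centralizer ({(⟨circleDiagonal N z₁, circleDiagonal_mem_archLocal_diagonal L N (α ∘ σ) w _⟩ : archLocal L N (Matrix.diagonal (α ∘ σ)) w)} : Set (archLocal L N (Matrix.diagonal (α ∘ σ)) w)))) [νH₁.IsHaarMeasure] [νH₁.IsInvInvariant]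
    (νH : Measure (Subgroup.centralizer ({(⟨circleDiagonal N (fun i => z₁ (σ.symm i)), circleDiagonal_mem_archLocal_diagonal L N α w _⟩ : archLocal L N (Matrix.diagonal α) w)} : Set (archLocal L N (Matrix.diagonal α) w)))) [νH.IsHaarMeasure] [νH.IsInvInvariant]
    (hνH : νH = νH₁.map (subgroupCongrHomeomorph (ContinuousMulEquiv.restrictSubgroup (GLn.conjEquiv (Matrix.GeneralLinearGroup.mkOfDetNeZero _ (det_monomial_one_ne_zero N σ)))
        (archLocal L N (Matrix.diagonal (α ∘ σ)) w) (archLocal L N (Matrix.diagonal α) w) (mem_archLocal_comp_perm_iff_conj_mem L N α w σ)).toMulEquiv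
      (Subgroup.centralizer ({(⟨circleDiagonal N z₁, circleDiagonal_mem_archLocal_diagonal L N (α ∘ σ) w _⟩ : archLocal L N (Matrix.diagonal (α ∘ σ)) w)} : Set (archLocal L N (Matrix.diagonal (α ∘ σ)) w))) (Subgroup.centralizer ({(⟨circleDiagonal N (fun i => z₁ (σ.symm i)), circleDiagonal_mem_archLocal_diagonal L N α w _⟩ : archLocal L N (Matrix.diagonal α) w)} : Set (archLocal L N (Matrix.diagonal α) w)))
      (forall_apply_mem_centralizer_singleton_iff_of_eq (ContinuousMulEquiv.restrictSubgroup (GLn.conjEquiv (Matrix.GeneralLinearGroup.mkOfDetNeZero _ (det_monomial_one_ne_zero N σ)))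
        (archLocal L N (Matrix.diagonal (α ∘ σ)) w) (archLocal L N (Matrix.diagonal α) w) (mem_archLocal_comp_perm_iff_conj_mem L N α w σ)).toMulEquiv (relabel_circleDiagonal L N α w σ z₁))
      (ContinuousMulEquiv.restrictSubgroup (GLn.conjEquiv (Matrix.GeneralLinearGroup.mkOfDetNeZero _ (det_monomial_one_ne_zero N σ)))
        (archLocal L N (Matrix.diagonal (α ∘ σ)) w) (archLocal L N (Matrix.diagonal α) w) (mem_archLocal_comp_perm_iff_conj_mem L N α w σ)).continuous (ContinuousMulEquiv.restrictSubgroup (GLn.conjEquiv (Matrix.GeneralLinearGroup.mkOfDetNeZero _ (det_monomial_one_ne_zero N σ)))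
        (archLocal L N (Matrix.diagonal (α ∘ σ)) w) (archLocal L N (Matrix.diagonal α) w) (mem_archLocal_comp_perm_iff_conj_mem L N α w σ)).symm.continuous))
    [MeasurableSpace (archLocal L N (Matrix.diagonal (α ∘ σ)) w ⧸ Subgroup.centralizer ({(⟨circleDiagonal N z₁, circleDiagonal_mem_archLocal_diagonal L N (α ∘ σ) w _⟩ : archLocal L N (Matrix.diagonal (α ∘ σ)) w)} : Set (archLocal L N (Matrix.diagonal (α ∘ σ)) w)))] [BorelSpace (archLocal L N (Matrix.diagonal (α ∘ σ)) w ⧸ Subgroup.centralizer ({(⟨circleDiagonal N z₁, circleDiagonal_mem_archLocal_diagonal L N (α ∘ σ) w _⟩ : archLocal L N (Matrix.diagonal (α ∘ σ)) w)} : Set (archLocal L N (Matrix.diagonal (α ∘ σ)) w)))]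
    [MeasurableSpace (archLocal L N (Matrix.diagonal α) w ⧸ Subgroup.centralizer ({(⟨circleDiagonal N (fun i => z₁ (σ.symm i)), circleDiagonal_mem_archLocal_diagonal L N α w _⟩ : archLocal L N (Matrix.diagonal α) w)} : Set (archLocal L N (Matrix.diagonal α) w)))] [BorelSpace (archLocal L N (Matrix.diagonal α) w ⧸ Subgroup.centralizer ({(⟨circleDiagonal N (fun i => z₁ (σ.symm i)), circleDiagonal_mem_archLocal_diagonal L N α w _⟩ : archLocal L N (Matrix.diagonal α) w)} : Set (archLocal L N (Matrix.diagonal α) w)))] :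
    ((quotientMeasure (Subgroup.centralizer ({(⟨circleDiagonal N z₁, circleDiagonal_mem_archLocal_diagonal L N (α ∘ σ) w _⟩ : archLocal L N (Matrix.diagonal (α ∘ σ)) w)} : Set (archLocal L N (Matrix.diagonal (α ∘ σ)) w))) νH₁ (isClosed_coe_centralizer_singleton _) ν₁).map
        (descConj (⟨circleDiagonal N z₀, circleDiagonal_mem_archLocal_diagonal L N (α ∘ σ) w _⟩ : archLocal L N (Matrix.diagonal (α ∘ σ)) w) (Subgroup.centralizer ({(⟨circleDiagonal N z₁, circleDiagonal_mem_archLocal_diagonal L N (α ∘ σ) w _⟩ : archLocal L N (Matrix.diagonal (α ∘ σ)) w)} : Set (archLocal L N (Matrix.diagonal (α ∘ σ)) w))) h₁ id)).map (ContinuousMulEquiv.restrictSubgroup (GLn.conjEquiv (Matrix.GeneralLinearGroup.mkOfDetNeZero _ (det_monomial_one_ne_zero N σ)))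
        (archLocal L N (Matrix.diagonal (α ∘ σ)) w) (archLocal L N (Matrix.diagonal α) w) (mem_archLocal_comp_perm_iff_conj_mem L N α w σ)) =
      (quotientMeasure (Subgroup.centralizer ({(⟨circleDiagonal N (fun i => z₁ (σ.symm i)), circleDiagonal_mem_archLocal_diagonal L N α w _⟩ : archLocal L N (Matrix.diagonal α) w)} : Set (archLocal L N (Matrix.diagonal α) w))) νH (isClosed_coe_centralizer_singleton _) ν).map
        (descConj (⟨circleDiagonal N (fun i => z₀ (σ.symm i)), circleDiagonal_mem_archLocal_diagonal L N α w _⟩ : archLocal L N (Matrix.diagonal α) w) (Subgroup.centralizer ({(⟨circleDiagonal N (fun i => z₁ (σ.symm i)), circleDiagonal_mem_archLocal_diagonal L N α w _⟩ : archLocal L N (Matrix.diagonal α) w)} : Set (archLocal L N (Matrix.diagonal α) w))) h id) := by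
  haveI : IsClosed ((Subgroup.centralizer ({(⟨circleDiagonal N z₁, circleDiagonal_mem_archLocal_diagonal L N (α ∘ σ) w _⟩ : archLocal L N (Matrix.diagonal (α ∘ σ)) w)} : Set (archLocal L N (Matrix.diagonal (α ∘ σ)) w)) : Subgroup (archLocal L N (Matrix.diagonal (α ∘ σ)) w)) : Set (archLocal L N (Matrix.diagonal (α ∘ σ)) w)) := isClosed_coe_centralizer_singleton _
  haveI : IsClosed ((Subgroup.centralizer ({(⟨circleDiagonal N (fun i => z₁ (σ.symm i)), circleDiagonal_mem_archLocal_diagonal L N α w _⟩ : archLocal L N (Matrix.diagonal α) w)} : Set (archLocal L N (Matrix.diagonal α) w)) : Subgroup (archLocal L N (Matrix.diagonal α) w)) : Set (archLocal L N (Matrix.diagonal α) w)) := isClosed_coe_centralizer_singleton _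
  exact map_map_descConj_id_quotientMeasure_eq_of_mulEquiv (ContinuousMulEquiv.restrictSubgroup (GLn.conjEquiv (Matrix.GeneralLinearGroup.mkOfDetNeZero _ (det_monomial_one_ne_zero N σ)))
        (archLocal L N (Matrix.diagonal (α ∘ σ)) w) (archLocal L N (Matrix.diagonal α) w) (mem_archLocal_comp_perm_iff_conj_mem L N α w σ)).toMulEquiv (ContinuousMulEquiv.restrictSubgroup (GLn.conjEquiv (Matrix.GeneralLinearGroup.mkOfDetNeZero _ (det_monomial_one_ne_zero N σ)))
        (archLocal L N (Matrix.diagonal (α ∘ σ)) w) (archLocal L N (Matrix.diagonal α) w) (mem_archLocal_comp_perm_iff_conj_mem L N α w σ)).continuous (ContinuousMulEquiv.restrictSubgroup (GLn.conjEquiv (Matrix.GeneralLinearGroup.mkOfDetNeZero _ (det_monomial_one_ne_zero N σ)))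
        (archLocal L N (Matrix.diagonal (α ∘ σ)) w) (archLocal L N (Matrix.diagonal α) w) (mem_archLocal_comp_perm_iff_conj_mem L N α w σ)).symm.continuous
    (Subgroup.centralizer ({(⟨circleDiagonal N z₁, circleDiagonal_mem_archLocal_diagonal L N (α ∘ σ) w _⟩ : archLocal L N (Matrix.diagonal (α ∘ σ)) w)} : Set (archLocal L N (Matrix.diagonal (α ∘ σ)) w))) (Subgroup.centralizer ({(⟨circleDiagonal N (fun i => z₁ (σ.symm i)), circleDiagonal_mem_archLocal_diagonal L N α w _⟩ : archLocal L N (Matrix.diagonal α) w)} : Set (archLocal L N (Matrix.diagonal α) w)))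
    (forall_apply_mem_centralizer_singleton_iff_of_eq (ContinuousMulEquiv.restrictSubgroup (GLn.conjEquiv (Matrix.GeneralLinearGroup.mkOfDetNeZero _ (det_monomial_one_ne_zero N σ)))
        (archLocal L N (Matrix.diagonal (α ∘ σ)) w) (archLocal L N (Matrix.diagonal α) w) (mem_archLocal_comp_perm_iff_conj_mem L N α w σ)).toMulEquiv (relabel_circleDiagonal L N α w σ z₁))
    νH₁ νH ν₁ ν hνH hν (relabel_circleDiagonal L N α w σ z₀) h₁ h

end Literature.NumberTheory.Rogawski1990

end
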